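import Literature.MathematicalPhysics.QuantumFieldTheory.Balaban1983to89.B9Eq3132NuReadingAtOne
import Literature.MathematicalPhysics.QuantumFieldTheory.Balaban1983to89.Node00.OpsYRecordV4P

/-!
# `Balaban1983to89.B9Eq3132AtOneFacesAtLetters` — T. Bałaban, *Propagators for lattice gauge theories in a background field*, Commun. Math. Phys. **99** (1985)
# 389–434 [Balaban1985BackgroundPropagators], (3.132) p. 422 with Cor. 3.5 p. 407 («for U = 1 these theorems are proved in [4]»): ROW 26's STATEMENT AT
# `U = 1` IS A THEOREM AT THE `ν`-INSTANCE OVER ANY LETTERS FAMILY WITH THE PRINTED `U = 1` FACES — in particular at node00-def-Y's re-fed record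
# `lettersYOfRecordV4P` (Sect.-D∕E composites on the print-units site propagator), instance `opsYNuOfRecordV4PE`

[4] = T. Bałaban, *Propagators and renormalization transformations for lattice gauge theories. II*, Commun. Math. Phys. **96** (1984) 223–250 [`Balaban1984PropagatorsII`].

statement-level skeleton of published theorems with citation tags; proofs where landed; nothing here is a claim about the Yang–Mills mass gap

THE PRINT.  [B9] p. 422 (3.132): *«|(QG̃Q*)⁻¹(U; y, y′)|, |(QG₁Q*)⁻¹(U; y, y′)| ≦ O(1)(Lʲη)⁻²(L^{j′}η)^{−d} exp(−δ d(y, y′))»*; p. 407 Cor. 3.5: *«For U = 1 these theorems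
are proved in [4]»*; [4] Prop. 2.7 (2.149) p. 249.

WHY THIS FILE (dag-n06-i gen 18, N06 bundle F4, row 26; A-column material, NOT a knit input).  `B9Eq3132NuReadingAtOne.ineq3132Nu_opsYNuOfRecordV4E_one`
(p510236) proves both (3.132) inequalities at `U = 1` at the v4 `ν`-instance of record — the non-vacuity witness of row 26's STATEMENT.  Edition 21 moves to
def-Y's re-fed record `lettersYOfRecordV4P` (`Node00.OpsYRecordV4P`, p587444): the Sect.-D∕E composites are fed `GpPhysY = η²•GpY`, so `(QGQ*)⁻¹(U)`,
`(QG₁Q*)⁻¹(U)` are DIFFERENT operators at curved `U` — but EQUAL at `U = 1` (def-Y `lettersYOfRecordV4P_one` ⇐ `QGQinvY_GpPhysY_one ∕ QG1QinvY_GpPhysY_one`).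
This file states the `U = 1` row once for ANY letters family whose two (3.132) letters have the printed `U = 1` face `(onFun EE)♯` ([4] (2.35)) and
instantiates it at the v4P record.

WHAT IS PROVED (sorry-free; bookkeeping over landed objects; `𝔸 = M_N(ℂ)`, `G = SU(N)`).
* §1 ★ `ineq3132Nu_opsYSectE_one_of (𝔏) (h1 h1')` — `∃ M₆ C δ, 0 < C ∧ 0 < δ ∧ ∀ x, M₆ ≤ M → B9.Ineq3132 (d+1) (INSTANCE x).QGQinv C δ 1 ∧ … .QG1Qinv …` at the
  instance shape `opsYSectE … (opsYS349NuOfLetters … 𝔏 𝔈) 𝔏 𝔢 𝔴` — `ineq3132Nu_one` ([4] Prop. 2.7, unconditional in the tree) twice.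
* §2 ★★ `ineq3132Nu_opsYNuOfRecordV4PE_one` — the same at `opsYNuOfRecordV4PE N θ M⋆ 𝔯 𝔢 𝔴 𝔈` (every `θ` with `4 ≤ θ.ℓ₆`, every `𝔯 𝔢 𝔴 𝔈`).

HONEST SCOPE.  [4] Prop. 2.7 at `U = 1` re-addressed; nothing of [B9] at curved `U` is asserted; COUNT-NEUTRAL; N06 NOT discharged; one finite 𝕋^{d+1} programme at
fixed ε — nothing continuum, nothing OS, nothing about the mass gap.  Cell `pub-ymgap` (HUMAN RULING D-0062), node N06 [B9], seat `pub-ymgap-dag-n06-i` (gen 18),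
2026-08-28; a NEW file.
-/

noncomputable section

namespace Literature.MathematicalPhysics.QuantumFieldTheory.Balaban1983to89.B9Eq3132AtOneFacesAtLetters

open Node00
open B6SectAVectorModelV1 (EE)
open B6GlobalChartV1 (domT)
open B6Ineq2133TwoScaleV1 (onFun)
open B9PinMembersKLevelV1 (MemberY geo9Y bg9Y)
open B7Prop2SpecialUnitary (specialUnitaryUnits)
open B9GeoLemma21KLevelV1 (geo9Y_len_pos)
open B9Eq3132SectDLetters (QGQinvY_one_liftEndY)
open B9Eq3132NuReading (opsYS349NuOfLetters)
open B9Eq3132NuReadingAtOne (ineq3132Nu_one)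
open scoped Matrix.Norms.L2Operator

variable {N : ℕ}

/-! ## §1 ★ Row 26 at `U = 1` at the `ν`-instance over any letters family with the printed `U = 1` faces -/

/-- ★ **AT `U = 1` BOTH ROW-26 INEQUALITIES HOLD AT THE `ν`-INSTANCE OVER ANY LETTERS FAMILY `𝔏`** whose `(QGQ*)⁻¹(1)` and `(QG₁Q*)⁻¹(1)` are the lift of
r03's `EE = (QGQ*)⁻¹` of [4] (2.35) (`h1 ∕ h1'` — at every def-Y record these are `QGQinvY_one_liftEndY` ∕ `QG1QinvY_one` over the printed laws
`parS_one ∕ parB_one ∕ Gp_one ∕ Δ2_one`): `B9Eq3132NuReadingAtOne.ineq3132Nu_opsYNuOfRecordV4E_one` letter-generic.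
[cite: Balaban1985BackgroundPropagators, (3.132) p.422, Cor. 3.5 p.407; Balaban1984PropagatorsII, Prop. 2.7 (2.149) p.249] -/
theorem ineq3132Nu_opsYSectE_one_of [NeZero N] (θ : Stage3Params) (hℓ : 4 ≤ θ.ℓ₆) (Mstar : ℕ) (𝔏 : LettersY N θ Mstar)
    (𝔢 : SectEY N θ Mstar) (𝔴 : RWEY N θ Mstar) (𝔈 : ExpsY N θ Mstar)
    (h1 : ∀ x : MemberY θ.d₆ θ.ℓ₆ θ.hd' θ.hL' θ.b₀ θ.b₁ Mstar,
      (𝔏 x).QGQinv (fun _ _ => 1) = liftEndY (Matrix (Fin N) (Fin N) ℂ) (onFun (EE (domT x.hN x.D x.hk) x.hcf x.hw)))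
    (h1' : ∀ x : MemberY θ.d₆ θ.ℓ₆ θ.hd' θ.hL' θ.b₀ θ.b₁ Mstar,
      (𝔏 x).QG1Qinv (fun _ _ => 1) = liftEndY (Matrix (Fin N) (Fin N) ℂ) (onFun (EE (domT x.hN x.D x.hk) x.hcf x.hw))) :
    ∃ M₆ C δ : ℝ, 0 < C ∧ 0 < δ ∧ ∀ x : MemberY θ.d₆ θ.ℓ₆ θ.hd' θ.hL' θ.b₀ θ.b₁ Mstar, M₆ ≤ (geo9Y x).M →
      B9.Ineq3132 (θ.d₆ + 1) (opsYSectE N θ Mstar (opsYS349NuOfLetters N θ Mstar 𝔏 𝔈) 𝔏 𝔢 𝔴 x).QGQinv C δ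
          (bg9Y (Matrix (Fin N) (Fin N) ℂ) (specialUnitaryUnits (Fin N)) x).one ∧
        B9.Ineq3132 (θ.d₆ + 1) (opsYSectE N θ Mstar (opsYS349NuOfLetters N θ Mstar 𝔏 𝔈) 𝔏 𝔢 𝔴 x).QG1Qinv C δ
          (bg9Y (Matrix (Fin N) (Fin N) ℂ) (specialUnitaryUnits (Fin N)) x).one := by
  obtain ⟨M₆, C, δ, hC, hδ, H⟩ := ineq3132Nu_one (specialUnitaryUnits (Fin N)) hℓ θ.hb.1 θ.hb.2 (θ.d₆ + 1) (fun x => (𝔏 x).QGQinv) h1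
  obtain ⟨M₆', C', δ', hC', hδ', H'⟩ := ineq3132Nu_one (specialUnitaryUnits (Fin N)) hℓ θ.hb.1 θ.hb.2 (θ.d₆ + 1) (fun x => (𝔏 x).QG1Qinv) h1'
  refine ⟨max M₆ M₆', max C C', min δ δ', lt_max_of_lt_left hC, lt_min hδ hδ', fun x hM => ⟨?_, ?_⟩⟩
  · exact B9Eq3132Whole.ineq3132_mono (θ.d₆ + 1) (fun y => (geo9Y_len_pos x y).le)
      (fun y y' => B9GeoNormsKLevelV1.geo9K_dist_nonneg x.toKIdx y y') (H x (le_trans (le_max_left _ _) hM))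
      (le_max_left _ _) (le_trans hC.le (le_max_left _ _)) (min_le_left _ _)
  · exact B9Eq3132Whole.ineq3132_mono (θ.d₆ + 1) (fun y => (geo9Y_len_pos x y).le)
      (fun y y' => B9GeoNormsKLevelV1.geo9K_dist_nonneg x.toKIdx y y') (H' x (le_trans (le_max_right _ _) hM))
      (le_max_right _ _) (le_trans hC.le (le_max_left _ _)) (min_le_right _ _)

/-! ## §2 ★★ At def-Y's re-fed instance of record `opsYNuOfRecordV4PE` -/

/-- ★★ **AT `U = 1` BOTH ROW-26 INEQUALITIES OF THE RE-FED `ν`-INSTANCE `opsYNuOfRecordV4PE` ARE THEOREMS** (every `θ` with `4 ≤ θ.ℓ₆`, every `𝔯 𝔢 𝔴 𝔈`): the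
print-units composites agree with the v4 ones at `U = 1` (`lettersYOfRecordV4P_one`), whose `U = 1` faces are `(onFun EE)♯` (`QGQinvY_one_liftEndY`, `QG1QinvY_one`
over the record's printed laws) — the A-column non-vacuity witness of edition 21's row 26. [cite: Balaban1985BackgroundPropagators, (3.132) p.422, Cor. 3.5 p.407; Balaban1984PropagatorsII, Prop. 2.7 (2.149) p.249] -/
theorem ineq3132Nu_opsYNuOfRecordV4PE_one [NeZero N] (θ : Stage3Params) (hℓ : 4 ≤ θ.ℓ₆) (Mstar : ℕ) (𝔯 : ResY N θ Mstar) (𝔢 : SectEY N θ Mstar)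
    (𝔴 : RWEY N θ Mstar) (𝔈 : ExpsY N θ Mstar) :
    ∃ M₆ C δ : ℝ, 0 < C ∧ 0 < δ ∧ ∀ x : MemberY θ.d₆ θ.ℓ₆ θ.hd' θ.hL' θ.b₀ θ.b₁ Mstar, M₆ ≤ (geo9Y x).M →
      B9.Ineq3132 (θ.d₆ + 1) (opsYNuOfRecordV4PE N θ Mstar 𝔯 𝔢 𝔴 𝔈 x).QGQinv C δ
          (bg9Y (Matrix (Fin N) (Fin N) ℂ) (specialUnitaryUnits (Fin N)) x).one ∧
        B9.Ineq3132 (θ.d₆ + 1) (opsYNuOfRecordV4PE N θ Mstar 𝔯 𝔢 𝔴 𝔈 x).QG1Qinv C δ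
          (bg9Y (Matrix (Fin N) (Fin N) ℂ) (specialUnitaryUnits (Fin N)) x).one := by
  have h1 : ∀ x : MemberY θ.d₆ θ.ℓ₆ θ.hd' θ.hL' θ.b₀ θ.b₁ Mstar,
      (lettersYOfRecordV4 N θ Mstar 𝔯 x).QGQinv (fun _ _ => 1) =
        liftEndY (Matrix (Fin N) (Fin N) ℂ) (onFun (EE (domT x.hN x.D x.hk) x.hcf x.hw)) := fun x =>
    QGQinvY_one_liftEndY x.toKIdx (lettersYOfRecordV4 N θ Mstar 𝔯 x).parS_one (lettersYOfRecordV4 N θ Mstar 𝔯 x).parB_one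
      (lettersYOfRecordV4 N θ Mstar 𝔯 x).Gp_one
  have h1' : ∀ x : MemberY θ.d₆ θ.ℓ₆ θ.hd' θ.hL' θ.b₀ θ.b₁ Mstar,
      (lettersYOfRecordV4 N θ Mstar 𝔯 x).QG1Qinv (fun _ _ => 1) =
        liftEndY (Matrix (Fin N) (Fin N) ℂ) (onFun (EE (domT x.hN x.D x.hk) x.hcf x.hw)) := fun x => by
    rw [← h1 x]
    exact QG1QinvY_one x.toKIdx _ _ _ (𝔯 x).Δ2_one
  exact ineq3132Nu_opsYSectE_one_of θ hℓ Mstar (lettersYOfRecordV4P N θ Mstar 𝔯) 𝔢 𝔴 𝔈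
    (fun x => ((lettersYOfRecordV4P_one N θ Mstar 𝔯 x).2.1).trans (h1 x))
    (fun x => ((lettersYOfRecordV4P_one N θ Mstar 𝔯 x).2.2.2.2.1).trans (h1' x))

end Literature.MathematicalPhysics.QuantumFieldTheory.Balaban1983to89.B9Eq3132AtOneFacesAtLetters

end
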